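import Literature.NumberTheory.GaloisRepresentations.PicardLambdaAdicRep
import Literature.NumberTheory.GaloisRepresentations.SuperellipticTwistedFixedPlaces
import Literature.NumberTheory.GaloisRepresentations.PicardTwistedCharacterSums
import Literature.NumberTheory.GaloisRepresentations.SuperellipticGenus
import Literature.NumberTheory.GaloisRepresentations.AbsIntegersResidueField
import Literature.NumberTheory.GaloisRepresentations.FramedRepBaseChange
import Literature.NumberTheory.EllipticCurves.TateModuleReductionTransfer
import HarnessLib

/-!
# The `λ`-adic representation of a Picard curve: unramifiedness, Frobenius traces, and the theorem
`picardCurve_exists_lambdaAdicRep` from the three classical inputs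

Topic `Literature/NumberTheory/GaloisRepresentations` (Upton 2009; continues `PicardLambdaAdicRep`).
The local analysis at a prime `𝔭 ∤ 3` of `K = ℚ(ω)` at which `f mod 𝔭` stays a separable quartic,
and the assembly of Upton's Theorem 2.1 / §4.  Three classical theorems not (yet) in the tree enter as
EXPLICIT HYPOTHESES (section variables `hX1`, `hX2`, `hX3`; they are not named facts):

* `hX1` — `Cl(F/M)[N] ≅ (ℤ/N)^{2g}` for a function field over an algebraically closed constant field
  (Rosen Thm. 11.12; Milne AV 8.2 / JV 1.1) — gives `#J_f[3ⁿ] = 3^{6n}` on both fibres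
  (`picard_hcard_of_hX1`, `card_torsionBy_reduction_of_hX1`, genus `3` by `genus_superelliptic_three_four`);
* `hX2` — good reduction of `Pic(C_f)` at such `𝔭`: an equivariant reduction map onto `Pic(C_{f̄})`
  injective/surjective on prime-to-`𝔭` torsion (Serre–Tate §1 Lemma 2, Thm. 1; Deuring);
* `hX3` — the twisted Lefschetz trace formula `tr(Frob ∘ ξ | V_ℓ) = q + 1 - #Fix(Frob ∘ ξ)`
  (Milne JV §11 Prop. 11.2 with `α = π ∘ ξ`).

Results (everything else proved in the tree):

* `picardRho1_isUnramifiedAt` — inertia acts trivially (Néron–Ogg–Shafarevich, easy direction, via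
  `TateModule.smul_eq_self_of_reduction`);
* `picard_trace_frob_deck` — `tr_{ℤ₃}(τ δ^i | T) = q + 1 - #Fix(Frob ∘ δ̄^i) = ω^{2i} a_𝔭(f) + ω^i a_𝔭(f²)`
  (transfer `trace_eq_of_injective_of_comp_eq`, `hX3`, `card_fixedPlaces_frobenius_deck`,
  `picard_twistedCount_eq_characterSum`);
* `trace_picardRho1_frob` — `tr ρ₁(Frob) = j(a_𝔭(f))` for `u = j(ω)²` (a nondegenerate `2 × 2` system);
* **`picardCurve_exists_lambdaAdicRep_of_torsion_goodReduction_lefschetz hX1 hX2 hX3 :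
  picardCurve_exists_lambdaAdicRep`** with `ρ = ρ₁^∨` (`trace_dual`, `isUnramifiedAt_dual_iff`,
  `IsAbsolutelyIrreducible.dual`).

## References
* C. Upton, *Galois representations attached to Picard curves*, J. Algebra 322 (2009), Thm. 2.1, §4. [Upton2009]
* J.-P. Serre, J. Tate, *Good reduction of abelian varieties*, Ann. Math. 88 (1968), §1. [SerreTate1968GoodReduction]
* J. S. Milne, *Jacobian varieties*, in Cornell–Silverman (1986), §11 Prop. 11.2. [Milne1986JacobianVarieties]
* M. Rosen, *Number Theory in Function Fields*, GTM 210 (2002), Thm. 11.12. [RosenFunctionFields2002]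
* K. Ireland, M. Rosen, *A Classical Introduction to Modern Number Theory* (1982), Ch. 8–9. [IrelandRosen1982]
-/

noncomputable section

open Polynomial




namespace Literature.NumberTheory.GaloisRepresentations

open Literature.NumberTheory.EllipticCurves Literature.NumberTheory.DiophantineGeometry
  Literature.NumberTheory.DiophantineGeometry.AlgFunctionField Field IsDedekindDomain
open scoped NumberField Pointwise

attribute [local instance] Ideal.Quotient.field

set_option synthInstance.maxHeartbeats 160000

section PicardLocal

variable (K : Type) [Field K] [NumberField K] [IsCyclotomicExtension {3} ℚ K]
variable (f : ℤ[X]) [hf4 : Fact (f.natDegree = 4)] [hfs : Fact (f.map (Int.castRingHom ℚ)).Separable]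

attribute [local instance] fact_irreducible_picard_inst picardEisensteinModule picard_isScalarTower_inst
  picard_smulCommClass_inst

omit [NumberField K] [IsCyclotomicExtension {3} ℚ K] hf4 hfs in
/-- The integral polynomial `f ∈ 𝓞_K[X]` mapping to `f_K`. [folklore] -/
theorem map_map_algebraMap_ringOfIntegers :
    (f.map (algebraMap ℤ (𝓞 K))).map (algebraMap (𝓞 K) K) = f.map (algebraMap ℤ K) := by
  rw [Polynomial.map_map]
  congr 1

omit [NumberField K] [IsCyclotomicExtension {3} ℚ K] hf4 hfs in
/-- `f mod 𝔭` in the two spellings. [folklore] -/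
theorem map_map_mk_ringOfIntegers (𝔭 : HeightOneSpectrum (𝓞 K)) :
    (f.map (algebraMap ℤ (𝓞 K))).map (Ideal.Quotient.mk 𝔭.asIdeal) =
      f.map ((Ideal.Quotient.mk 𝔭.asIdeal).comp (algebraMap ℤ (𝓞 K))) := by
  rw [Polynomial.map_map]

variable {K f}

/-- `ω^i t = δ^i t` on `T₃ J(C_f)`. [folklore] -/
theorem omega_pow_smul_tateModule (i : ℕ) (t : TateModule (GeomPic K 3 (f.map (algebraMap ℤ K))) 3) :
    PadicEisenstein.omega ^ i • t = deckGen (isPrimitiveRoot_zeta3 K) ^ i • t := by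
  induction i with
  | zero => rw [pow_zero, pow_zero, one_smul, one_smul]
  | succ i ih =>
    rw [pow_succ', mul_smul, ih, pow_succ', mul_smul,
      omega_smul_tateModule (isPrimitiveRoot_zeta3 K) (separable_map_algebraMap_int K hfs.out)
        (not_three_dvd_natDegree_map K hf4.out)]

/-- `tr_{ℤ₃}(τ δ^i | T) = Tr_{ℤ₃[ω]/ℤ₃}(ω^i · tr_{ℤ₃[ω]}(τ | T))`. [cite: SerreAbelianLadic1968, Ch. I §1.1] -/
theorem trace_frob_deck_eq_algebraTrace
    (b : Module.Basis (Fin 3) PadicEisenstein (TateModule (GeomPic K 3 (f.map (algebraMap ℤ K))) 3))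
    (τ : absoluteGaloisGroup K) (i : ℕ) :
    LinearMap.trace ℤ_[3] _
      (DistribSMul.toLinearMap ℤ_[3] (TateModule (GeomPic K 3 (f.map (algebraMap ℤ K))) 3) τ ∘ₗ
        DistribSMul.toLinearMap ℤ_[3] (TateModule (GeomPic K 3 (f.map (algebraMap ℤ K))) 3)
          (deckGen (isPrimitiveRoot_zeta3 K) ^ i)) =
      Algebra.trace ℤ_[3] PadicEisenstein (PadicEisenstein.omega ^ i *
        LinearMap.trace PadicEisenstein _
          (DistribMulAction.toModuleEnd PadicEisenstein (TateModule (GeomPic K 3 (f.map (algebraMap ℤ K))) 3) τ)) := by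
  have h := trace_restrictScalars_eq_trace_trace PadicEisenstein.basisFinTwo b
    (PadicEisenstein.omega ^ i •
      DistribMulAction.toModuleEnd PadicEisenstein (TateModule (GeomPic K 3 (f.map (algebraMap ℤ K))) 3) τ)
  rw [map_smul, smul_eq_mul] at h
  rw [← h]
  congr 1
  refine LinearMap.ext fun t => ?_
  change τ • (deckGen (isPrimitiveRoot_zeta3 K) ^ i • t) = PadicEisenstein.omega ^ i • (τ • t)
  rw [omega_pow_smul_tateModule]
  exact absoluteGaloisGroup_smul_deck_smul_tateModule K 3 _ ⟨zeta3 K, isPrimitiveRoot_zeta3 K⟩ 3 τ _ t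

/-- The two embeddings `ω ↦ u, u²` of `ℤ₃[ω]` into `ℚ̄₃` sum to the trace:
`σ(z) + σ̄(z) = Tr_{ℤ₃[ω]/ℤ₃}(z)`. [folklore] -/
theorem lift_add_lift_sq_eq_algebraMap_trace (u : PadicAlgCl 3) (hu : u ^ 2 + u + 1 = 0)
    (hu' : (u ^ 2) ^ 2 + u ^ 2 + 1 = 0) (z : PadicEisenstein) :
    PadicEisenstein.lift u hu z + PadicEisenstein.lift (u ^ 2) hu' z =
      algebraMap ℤ_[3] (PadicAlgCl 3) (Algebra.trace ℤ_[3] PadicEisenstein z) := by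
  obtain ⟨a, c, rfl⟩ := PadicEisenstein.exists_eq_add_mul_omega z
  rw [PadicEisenstein.lift_add_mul_omega, PadicEisenstein.lift_add_mul_omega, PadicEisenstein.trace_add_mul_omega]
  simp only [map_sub, map_mul, map_ofNat]
  linear_combination (algebraMap ℤ_[3] (PadicAlgCl 3) c) * hu

/-- `u²` is the other primitive cube root of unity. [folklore] -/
theorem sq_sq_add_sq_add_one {R : Type*} [CommRing R] {u : R} (hu : u ^ 2 + u + 1 = 0) :
    (u ^ 2) ^ 2 + u ^ 2 + 1 = 0 := by
  have h3 : u ^ 3 = 1 := by linear_combination (u - 1) * hu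
  linear_combination hu + u * h3

/-! ### The special fibre: hypotheses `hX1` (torsion of Jacobians), `hX2` (good reduction), `hX3`
(twisted Lefschetz trace formula) as section variables -/

variable
  (hX1 : ∀ (M : Type) (F : Type) [Field M] [Field F] [Algebra M F] [IsAlgClosed M] [IsAlgFunctionField M F]
    (N : ℕ), (N : M) ≠ 0 → Nonempty ((AddSubgroup.torsionBy (DivisorClass M F) N) ≃+ (Fin (2 * genus M F) → ZMod N)))
  (hX2 : ∀ (K : Type) [Field K] [NumberField K] (p : ℕ) [Fact p.Prime] (f : K[X]) (f₀ : (𝓞 K)[X]),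
    f₀.map (algebraMap (𝓞 K) K) = f →
    ∀ (𝔭 : HeightOneSpectrum (𝓞 K)) (𝔓 : Ideal (absIntegers (𝓞 K) K)) [𝔓.IsMaximal] [𝔓.LiesOver 𝔭.asIdeal],
    (p : 𝓞 K) ∉ 𝔭.asIdeal → ¬ p ∣ f.natDegree →
    (f₀.map (Ideal.Quotient.mk 𝔭.asIdeal)).natDegree = f.natDegree →
    (f₀.map (Ideal.Quotient.mk 𝔭.asIdeal)).Separable →
    ∀ [Fact (Irreducible (superellipticPoly K (AlgebraicClosure K) p f))]
      [Fact (Irreducible (superellipticPoly (𝓞 K ⧸ 𝔭.asIdeal) (absIntegers (𝓞 K) K ⧸ 𝔓) p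
        (f₀.map (Ideal.Quotient.mk 𝔭.asIdeal))))],
    ∃ red : GeomPic K p f →+
        SuperellipticPic (𝓞 K ⧸ 𝔭.asIdeal) (absIntegers (𝓞 K) K ⧸ 𝔓) p (f₀.map (Ideal.Quotient.mk 𝔭.asIdeal)),
      (∀ (τ : MulAction.stabilizer (absoluteGaloisGroup K) 𝔓) (c : GeomPic K p f),
          red ((τ : absoluteGaloisGroup K) • c) =
            (Ideal.Quotient.stabilizerHom 𝔓 𝔭.asIdeal (absoluteGaloisGroup K) τ) • red c) ∧
      (∀ (ζ : CyclicCoverDeck (AlgebraicClosure K) p) (c : GeomPic K p f),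
          red (ζ • c) = CyclicCoverDeck.reduceMod K p 𝔓 ζ • red c) ∧
      (∀ N : ℕ, (N : 𝓞 K ⧸ 𝔭.asIdeal) ≠ 0 →
        (∀ c : GeomPic K p f, N • c = 0 → red c = 0 → c = 0) ∧
        (∀ c', N • c' = 0 → ∃ c : GeomPic K p f, N • c = 0 ∧ red c = c')))
  (hX3 : ∀ (k : Type) [Field k] [Fintype k] (Ω : Type) [Field Ω] [Algebra k Ω] [IsAlgClosed Ω]
    [Algebra.IsAlgebraic k Ω] (p : ℕ) [Fact p.Prime] (ℓ : ℕ) [Fact ℓ.Prime] (f : k[X]),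
    (p : k) ≠ 0 → (ℓ : k) ≠ 0 → f.Separable → ¬ p ∣ f.natDegree →
    ∀ [Fact (Irreducible (superellipticPoly k Ω p f))] (φ : Ω ≃ₐ[k] Ω), (∀ x : Ω, φ x = x ^ Fintype.card k) →
    ∀ (ξ : CyclicCoverDeck Ω p),
      LinearMap.trace ℚ_[ℓ] (RationalTateModule (SuperellipticPic k Ω p f) ℓ)
        (rationalTateRepresentation (Ω ≃ₐ[k] Ω) (SuperellipticPic k Ω p f) ℓ φ ∘ₗ
          rationalTateRepresentation (CyclicCoverDeck Ω p) (SuperellipticPic k Ω p f) ℓ ξ) =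
        (Fintype.card k : ℚ_[ℓ]) + 1 -
          Nat.card {P : PlaceOver Ω (SuperellipticFunctionField k Ω p f) // φ • (ξ • P) = P})

include hX1 in
/-- `#Cl(F/M)[ℓⁿ] = ℓ^{2gn}` from `hX1`. [cite: RosenFunctionFields2002, Ch. 11, Thm. 11.12] -/
theorem card_torsionBy_divisorClass_pow_of_hX1 (M : Type) (F : Type) [Field M] [Field F] [Algebra M F]
    [IsAlgClosed M] [IsAlgFunctionField M F] {ℓ : ℕ} (hℓ : (ℓ : M) ≠ 0) (n : ℕ) :
    Nat.card (AddSubgroup.torsionBy (DivisorClass M F) (ℓ ^ n : ℕ)) = ℓ ^ (2 * genus M F * n) := by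
  obtain ⟨e⟩ := hX1 M F (ℓ ^ n) (by exact_mod_cast pow_ne_zero n hℓ)
  rw [Nat.card_congr e.toEquiv, Nat.card_fun, Nat.card_zmod, Nat.card_eq_fintype_card, Fintype.card_fin, ← pow_mul,
    mul_comm]

omit [IsCyclotomicExtension {3} ℚ K] in
include hX1 in
/-- **`#J_f[3ⁿ] = 3^{6n}`** for the Picard curve over `K̄` (genus `3`), from `hX1`. [cite: Upton2009, §2] -/
theorem picard_hcard_of_hX1 :
    ∀ n, Nat.card (AddSubgroup.torsionBy (GeomPic K 3 (f.map (algebraMap ℤ K))) (3 ^ n : ℕ)) = 3 ^ (2 * 3 * n) := by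
  intro n
  have hg := SuperellipticFunctionField.genus_superelliptic_three_four (K := K) (L := AlgebraicClosure K) (f := f.map (algebraMap ℤ K))
    three_ne_zero (separable_map_algebraMap_int K hfs.out) (natDegree_map_algebraMap_int_eq K hf4.out)
  have h := card_torsionBy_divisorClass_pow_of_hX1 hX1 (AlgebraicClosure K)
    (SuperellipticFunctionField K (AlgebraicClosure K) 3 (f.map (algebraMap ℤ K))) (ℓ := 3) three_ne_zero n
  rw [hg] at h
  exact h

/-! ### The reduction datum at a good prime and its consequences -/

section GoodPrime

variable {𝔭 : HeightOneSpectrum (𝓞 K)} (h3𝔭 : (3 : 𝓞 K) ∉ 𝔭.asIdeal)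
  (hdeg𝔭 : (f.map ((Ideal.Quotient.mk 𝔭.asIdeal).comp (algebraMap ℤ (𝓞 K)))).natDegree = 4)
  (hsep𝔭 : (f.map ((Ideal.Quotient.mk 𝔭.asIdeal).comp (algebraMap ℤ (𝓞 K)))).Separable)
  {𝔓 : Ideal (absIntegers (𝓞 K) K)} [𝔓.IsMaximal] [h𝔓over : 𝔓.LiesOver 𝔭.asIdeal]

omit [NumberField K] [IsCyclotomicExtension {3} ℚ K] [𝔓.IsMaximal] in
/-- A maximal `𝔓` over `𝔭` is in `𝔭.primesAbove`. [folklore] -/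
theorem mem_primesAbove_of_liesOver [h𝔓max : 𝔓.IsMaximal] : 𝔓 ∈ 𝔭.primesAbove :=
  ⟨h𝔓max.isPrime, h𝔓over⟩

omit [NumberField K] [IsCyclotomicExtension {3} ℚ K] in
include h3𝔭 in
/-- `3 ≠ 0` in `𝓞 K / 𝔭`. [folklore] -/
theorem three_ne_zero_residue : (3 : 𝓞 K ⧸ 𝔭.asIdeal) ≠ 0 := by
  intro h
  apply h3𝔭
  rw [← Ideal.Quotient.eq_zero_iff_mem, map_ofNat, h]

omit [IsCyclotomicExtension {3} ℚ K] hf4 hfs in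
include hdeg𝔭 hsep𝔭 in
/-- (Instance at a good prime.) `y³ - f̄(x)` is irreducible over `κ(𝔓)(x)`. [folklore] -/
theorem fact_irreducible_reduction_inst :
    Fact (Irreducible (superellipticPoly (𝓞 K ⧸ 𝔭.asIdeal) (absIntegers (𝓞 K) K ⧸ 𝔓) 3
      ((f.map (algebraMap ℤ (𝓞 K))).map (Ideal.Quotient.mk 𝔭.asIdeal)))) := by
  haveI : Fact (Nat.Prime 3) := ⟨Nat.prime_three⟩
  refine fact_irreducible_superellipticPoly (𝓞 K ⧸ 𝔭.asIdeal) (absIntegers (𝓞 K) K ⧸ 𝔓) _ ?_ ?_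
  · rw [map_map_mk_ringOfIntegers]; exact hsep𝔭
  · rw [map_map_mk_ringOfIntegers, hdeg𝔭]; norm_num

omit [IsCyclotomicExtension {3} ℚ K] in
include hX2 h3𝔭 hdeg𝔭 hsep𝔭 in
/-- **The good-reduction datum for the Picard curve at `𝔭 ∤ 3` of good reduction** (from `hX2`).
[cite: SerreTate1968GoodReduction, §1, Lemma 2 and Thm. 1] -/
theorem picard_exists_reduction :
    haveI := fact_irreducible_reduction_inst (K := K) (f := f) hdeg𝔭 hsep𝔭 (𝔓 := 𝔓)
    ∃ red : GeomPic K 3 (f.map (algebraMap ℤ K)) →+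
        SuperellipticPic (𝓞 K ⧸ 𝔭.asIdeal) (absIntegers (𝓞 K) K ⧸ 𝔓) 3
          ((f.map (algebraMap ℤ (𝓞 K))).map (Ideal.Quotient.mk 𝔭.asIdeal)),
      (∀ (τ : MulAction.stabilizer (absoluteGaloisGroup K) 𝔓) (c : GeomPic K 3 (f.map (algebraMap ℤ K))),
          red ((τ : absoluteGaloisGroup K) • c) =
            (Ideal.Quotient.stabilizerHom 𝔓 𝔭.asIdeal (absoluteGaloisGroup K) τ) • red c) ∧
      (∀ (ζ : CyclicCoverDeck (AlgebraicClosure K) 3) (c : GeomPic K 3 (f.map (algebraMap ℤ K))),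
          red (ζ • c) = CyclicCoverDeck.reduceMod K 3 𝔓 ζ • red c) ∧
      (∀ (n : ℕ) (c : GeomPic K 3 (f.map (algebraMap ℤ K))), 3 ^ n • c = 0 → red c = 0 → c = 0) := by
  haveI := fact_irreducible_reduction_inst (K := K) (f := f) hdeg𝔭 hsep𝔭 (𝔓 := 𝔓)
  haveI : Fact (Nat.Prime 3) := ⟨Nat.prime_three⟩
  obtain ⟨red, hτ, hζ, hN⟩ := hX2 K 3 (f.map (algebraMap ℤ K)) (f.map (algebraMap ℤ (𝓞 K)))
    (map_map_algebraMap_ringOfIntegers K f) 𝔭 𝔓 (by exact_mod_cast h3𝔭) (not_three_dvd_natDegree_map K hf4.out)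
    (by rw [map_map_mk_ringOfIntegers, hdeg𝔭, natDegree_map_algebraMap_int_eq K hf4.out])
    (by rw [map_map_mk_ringOfIntegers]; exact hsep𝔭)
  refine ⟨red, hτ, hζ, fun n c h3c hc => (hN (3 ^ n) ?_).1 c h3c hc⟩
  rw [Nat.cast_pow]
  exact pow_ne_zero n (three_ne_zero_residue h3𝔭)

include hX2 h3𝔭 hdeg𝔭 hsep𝔭 in
/-- **`ρ₁` is unramified at a prime `𝔭 ∤ 3` of good reduction**: the inertia group at `𝔓 ∣ 𝔭` acts
trivially on the reduction `Pic(C̄)`, hence (reduction being injective on `3`-power torsion) on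
`T₃ J(C_f)` — the criterion of Néron–Ogg–Shafarevich, easy direction (Serre–Tate Thm. 1).
[cite: SerreTate1968GoodReduction, §1, Thm. 1] [cite: Upton2009, §2] -/
theorem picardRho1_isUnramifiedAt
    (hcard : ∀ n, Nat.card (AddSubgroup.torsionBy (GeomPic K 3 (f.map (algebraMap ℤ K))) (3 ^ n : ℕ)) = 3 ^ (2 * 3 * n))
    (b : Module.Basis (Fin 3) PadicEisenstein (TateModule (GeomPic K 3 (f.map (algebraMap ℤ K))) 3))
    (u : PadicAlgCl 3) (hu : u ^ 2 + u + 1 = 0) :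
    (picardRho1 hcard b u hu).IsUnramifiedAt 𝔭 := by
  intro 𝔓 h𝔓 σ hσ
  haveI := HeightOneSpectrum.isMaximal_of_mem_primesAbove h𝔓
  haveI : 𝔓.LiesOver 𝔭.asIdeal := h𝔓.2
  obtain ⟨red, hτ, -, hinj⟩ := picard_exists_reduction (K := K) (f := f) hX2 h3𝔭 hdeg𝔭 hsep𝔭 (𝔓 := 𝔓)
  -- the inertia element `σ` acts trivially on the reduction, hence on `T`
  have hσD : σ ∈ MulAction.stabilizer (absoluteGaloisGroup K) 𝔓 := Ideal.inertia_le_stabilizer 𝔓 hσ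
  have hone : Ideal.Quotient.stabilizerHom 𝔓 𝔭.asIdeal (absoluteGaloisGroup K) ⟨σ, hσD⟩ = 1 := by
    rw [← MonoidHom.mem_ker, Ideal.Quotient.ker_stabilizerHom]
    exact hσ
  have hfix : ∀ t : TateModule (GeomPic K 3 (f.map (algebraMap ℤ K))) 3, σ • t = t :=
    TateModule.smul_eq_self_of_reduction red hinj σ fun c => by
      have h := hτ ⟨σ, hσD⟩ c
      rwa [hone, one_smul] at h
  refine Units.ext (Matrix.ext fun i j => ?_)
  rw [picardRho1_apply_coe, picardMatrixRepO_apply, hfix, b.repr_self, Finsupp.single_apply, Units.val_one,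
    Matrix.one_apply]
  by_cases h : i = j
  · subst h
    rw [if_pos rfl, if_pos rfl, map_one]
  · rw [if_neg (Ne.symm h), if_neg h, map_zero]

omit [IsCyclotomicExtension {3} ℚ K] hf4 hfs in
include hX1 hdeg𝔭 hsep𝔭 h3𝔭 in
/-- The special fibre has `#Pic(C̄)[3ⁿ] = 3^{6n}` too (genus `3`, from `hX1`). [cite: Upton2009, §2] -/
theorem card_torsionBy_reduction_of_hX1 :
    haveI := fact_irreducible_reduction_inst (K := K) (f := f) hdeg𝔭 hsep𝔭 (𝔓 := 𝔓)
    ∀ n, Nat.card (AddSubgroup.torsionBy (SuperellipticPic (𝓞 K ⧸ 𝔭.asIdeal) (absIntegers (𝓞 K) K ⧸ 𝔓) 3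
      ((f.map (algebraMap ℤ (𝓞 K))).map (Ideal.Quotient.mk 𝔭.asIdeal))) (3 ^ n : ℕ)) = 3 ^ (2 * 3 * n) := by
  haveI := fact_irreducible_reduction_inst (K := K) (f := f) hdeg𝔭 hsep𝔭 (𝔓 := 𝔓)
  haveI : IsAlgClosed (absIntegers (𝓞 K) K ⧸ 𝔓) := absIntegers.isAlgClosed_quotient 𝔓
  intro n
  have h3κ : (3 : absIntegers (𝓞 K) K ⧸ 𝔓) ≠ 0 := by
    rw [show (3 : absIntegers (𝓞 K) K ⧸ 𝔓) = algebraMap (𝓞 K ⧸ 𝔭.asIdeal) _ 3 by rw [map_ofNat]]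
    exact (map_ne_zero_iff _ (algebraMap (𝓞 K ⧸ 𝔭.asIdeal) (absIntegers (𝓞 K) K ⧸ 𝔓)).injective).2
      (three_ne_zero_residue h3𝔭)
  have hg := SuperellipticFunctionField.genus_superelliptic_three_four (K := 𝓞 K ⧸ 𝔭.asIdeal)
    (L := absIntegers (𝓞 K) K ⧸ 𝔓) (f := (f.map (algebraMap ℤ (𝓞 K))).map (Ideal.Quotient.mk 𝔭.asIdeal)) h3κ
    (by rw [map_map_mk_ringOfIntegers]; exact hsep𝔭) (by rw [map_map_mk_ringOfIntegers]; exact hdeg𝔭)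
  have h := card_torsionBy_divisorClass_pow_of_hX1 hX1 (absIntegers (𝓞 K) K ⧸ 𝔓)
    (SuperellipticFunctionField (𝓞 K ⧸ 𝔭.asIdeal) (absIntegers (𝓞 K) K ⧸ 𝔓) 3
      ((f.map (algebraMap ℤ (𝓞 K))).map (Ideal.Quotient.mk 𝔭.asIdeal))) (ℓ := 3) h3κ n
  rw [hg] at h
  exact h

omit [IsCyclotomicExtension {3} ℚ K] [𝔓.IsMaximal] in
/-- An arithmetic Frobenius at `𝔓 ∣ 𝔭` induces the `q`-power map on `κ(𝔓)`, `q = N𝔭`. [folklore] -/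
theorem stabilizerHom_apply_eq_pow [h𝔓max : 𝔓.IsMaximal] [Fintype (𝓞 K ⧸ 𝔭.asIdeal)] (τ : absoluteGaloisGroup K)
    (hτ : IsArithFrobAt (𝓞 K) τ 𝔓) (x : absIntegers (𝓞 K) K ⧸ 𝔓) :
    Ideal.Quotient.stabilizerHom 𝔓 𝔭.asIdeal (absoluteGaloisGroup K) ⟨τ, hτ.mem_stabilizer⟩ x =
      x ^ Fintype.card (𝓞 K ⧸ 𝔭.asIdeal) := by
  have h𝔓 : 𝔓 ∈ 𝔭.primesAbove := mem_primesAbove_of_liesOver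
  have hq : Fintype.card (𝓞 K ⧸ 𝔭.asIdeal) = 𝔭.residueCard := by
    rw [HeightOneSpectrum.residueCard_eq_card_quotient, Nat.card_eq_fintype_card]
  obtain ⟨y, rfl⟩ := Ideal.Quotient.mk_surjective x
  rw [Ideal.Quotient.stabilizerHom_apply, ← map_pow, hq]
  change Ideal.Quotient.mk 𝔓 (τ • y) = _
  rw [Ideal.Quotient.eq]
  exact (HeightOneSpectrum.isArithFrobAt_iff_of_mem_primesAbove h𝔓 τ).1 hτ y

/-- `tr_{ℚ_ℓ}(V(h) ∘ V(η)) = tr_{ℤ_ℓ}(T(h) ∘ T(η))` on a Tate module free of finite rank. [folklore] -/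
theorem trace_rationalTateRepresentation_comp {A : Type} [AddCommGroup A] {ℓ : ℕ} [Fact ℓ.Prime]
    {G : Type*} [Monoid G] [DistribMulAction G A] {H : Type*} [Monoid H] [DistribMulAction H A]
    [Module.Free ℤ_[ℓ] (TateModule A ℓ)] [Module.Finite ℤ_[ℓ] (TateModule A ℓ)] (g : G) (h : H) :
    LinearMap.trace ℚ_[ℓ] (RationalTateModule A ℓ)
        (rationalTateRepresentation G A ℓ g ∘ₗ rationalTateRepresentation H A ℓ h) =
      algebraMap ℤ_[ℓ] ℚ_[ℓ] (LinearMap.trace ℤ_[ℓ] _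
        (DistribSMul.toLinearMap ℤ_[ℓ] (TateModule A ℓ) g ∘ₗ DistribSMul.toLinearMap ℤ_[ℓ] (TateModule A ℓ) h)) := by
  rw [← LinearMap.trace_baseChange, LinearMap.baseChange_comp]
  rfl

omit [𝔓.IsMaximal] in
/-- The reduced deck transformation multiplies `y` by `ω^i mod 𝔓`. [folklore] -/
theorem val_reduceMod_deckGen_pow [𝔓.IsMaximal] (i : ℕ) :
    (CyclicCoverDeck.reduceMod K 3 𝔓 (deckGen (isPrimitiveRoot_zeta3 K) ^ i)).val =
      algebraMap (𝓞 K ⧸ 𝔭.asIdeal) (absIntegers (𝓞 K) K ⧸ 𝔓) (Ideal.Quotient.mk 𝔭.asIdeal (zeta3Int K ^ i)) := by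
  rw [CyclicCoverDeck.val_reduceMod]
  change Ideal.Quotient.mk 𝔓 _ = Ideal.Quotient.mk 𝔓 (algebraMap (𝓞 K) (absIntegers (𝓞 K) K) (zeta3Int K ^ i))
  congr 1
  refine Subtype.ext ?_
  rw [CyclicCoverDeck.coe_toAbsIntegers, CyclicCoverDeck.val_pow_eq_pow_val, deckGen, CyclicCoverDeck.val_ofRoot,
    map_pow, SubmonoidClass.coe_pow]
  rfl

include hX1 hX2 hX3 h3𝔭 hdeg𝔭 hsep𝔭 in
set_option maxHeartbeats 800000 in
/-- **`tr_{ℤ₃}(τ δ^i | T₃ J(C_f))` at a Frobenius `τ` is the twisted point count**: for `τ` an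
arithmetic Frobenius at `𝔓 ∣ 𝔭` (`𝔭 ∤ 3` of good reduction) and `i < 3`,
`tr_{ℤ₃}(τ ∘ δ^i | T) = m` with `m = q + 1 - #{P ∈ C̄(𝔽̄) : Frob(δ̄^i P) = P} ∈ ℤ` and
`m = ω^{2i} a_𝔭(f) + ω^i a_𝔭(f²)` in `𝓞 K` — transfer to the special fibre along the good-reduction
datum (`hX2`, `TateModuleReductionTransfer`), twisted Lefschetz trace formula (`hX3`), fixed places of
`Frob ∘ δ̄^i` (`card_fixedPlaces_frobenius_deck`) and cubic character sums
(`picard_twistedCount_eq_characterSum`). (Upton 2009, §2, proof of Thm. 2.1; Holzapfel.)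
[cite: Upton2009, §2] [cite: Milne1986JacobianVarieties, §11 Prop. 11.2] -/
theorem picard_trace_frob_deck (τ : absoluteGaloisGroup K) (hτ : IsArithFrobAt (𝓞 K) τ 𝔓) {i : ℕ} (hi : i < 3) :
    ∃ m : ℤ,
      LinearMap.trace ℤ_[3] _
        (DistribSMul.toLinearMap ℤ_[3] (TateModule (GeomPic K 3 (f.map (algebraMap ℤ K))) 3) τ ∘ₗ
          DistribSMul.toLinearMap ℤ_[3] (TateModule (GeomPic K 3 (f.map (algebraMap ℤ K))) 3)
            (deckGen (isPrimitiveRoot_zeta3 K) ^ i)) = m ∧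
      (m : 𝓞 K) = (zeta3Int K ^ i) ^ 2 * picardTrace f 𝔭 + zeta3Int K ^ i * picardTrace (f ^ 2) 𝔭 := by
  classical
  haveI : Fact (Nat.Prime 3) := ⟨Nat.prime_three⟩
  haveI := fact_irreducible_reduction_inst (K := K) (f := f) hdeg𝔭 hsep𝔭 (𝔓 := 𝔓)
  letI : Fintype (𝓞 K ⧸ 𝔭.asIdeal) := Fintype.ofFinite (𝓞 K ⧸ 𝔭.asIdeal)
  haveI : IsAlgClosed (absIntegers (𝓞 K) K ⧸ 𝔓) := absIntegers.isAlgClosed_quotient 𝔓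
  haveI : Algebra.IsAlgebraic (𝓞 K ⧸ 𝔭.asIdeal) (absIntegers (𝓞 K) K ⧸ 𝔓) := inferInstance
  have hfb' : ((f.map (algebraMap ℤ (𝓞 K))).map (Ideal.Quotient.mk 𝔭.asIdeal)) = f.map ((Ideal.Quotient.mk 𝔭.asIdeal).comp (algebraMap ℤ (𝓞 K))) :=
    map_map_mk_ringOfIntegers K f 𝔭
  have h3k : (3 : (𝓞 K ⧸ 𝔭.asIdeal)) ≠ 0 := three_ne_zero_residue h3𝔭
  have hq : Fintype.card (𝓞 K ⧸ 𝔭.asIdeal) = 𝔭.residueCard := by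
    rw [HeightOneSpectrum.residueCard_eq_card_quotient, Nat.card_eq_fintype_card]
  have hdegb : ((f.map (algebraMap ℤ (𝓞 K))).map (Ideal.Quotient.mk 𝔭.asIdeal)).natDegree = 4 := by rw [hfb']; exact hdeg𝔭
  have hsepb : ((f.map (algebraMap ℤ (𝓞 K))).map (Ideal.Quotient.mk 𝔭.asIdeal)).Separable := by rw [hfb']; exact hsep𝔭
  have hndvdb : ¬ 3 ∣ ((f.map (algebraMap ℤ (𝓞 K))).map (Ideal.Quotient.mk 𝔭.asIdeal)).natDegree := by rw [hdegb]; decide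
  have hpq : 3 ∣ Fintype.card (𝓞 K ⧸ 𝔭.asIdeal) - 1 := by
    rw [hq]; exact three_dvd_residueCard_sub_one (isPrimitiveRoot_zeta3Int K) h3𝔭
  -- the reduction datum and ranks
  obtain ⟨red, hredτ, hredζ, hinj⟩ := picard_exists_reduction (K := K) (f := f) hX2 h3𝔭 hdeg𝔭 hsep𝔭 (𝔓 := 𝔓)
  have hcard' := card_torsionBy_reduction_of_hX1 (K := K) (f := f) hX1 h3𝔭 hdeg𝔭 hsep𝔭 (𝔓 := 𝔓)
  have hcard := picard_hcard_of_hX1 (K := K) (f := f) hX1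
  haveI := TateModule.free_of_card_torsionBy_rank hcard
  haveI := TateModule.finite_of_card_torsionBy_rank hcard
  haveI := TateModule.free_of_card_torsionBy_rank hcard'
  haveI := TateModule.finite_of_card_torsionBy_rank hcard'
  have hrank : Module.finrank ℤ_[3] (TateModule (GeomPic K 3 (f.map (algebraMap ℤ K))) 3) =
      Module.finrank ℤ_[3] (TateModule (SuperellipticPic (𝓞 K ⧸ 𝔭.asIdeal) (absIntegers (𝓞 K) K ⧸ 𝔓) 3 ((f.map (algebraMap ℤ (𝓞 K))).map (Ideal.Quotient.mk 𝔭.asIdeal))) 3) := by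
    rw [TateModule.finrank_eq_of_card_torsionBy hcard, TateModule.finrank_eq_of_card_torsionBy hcard']
  -- the Frobenius automorphism of `κ(𝔓)` and the reduced deck transformation
  set φ : (absIntegers (𝓞 K) K ⧸ 𝔓) ≃ₐ[(𝓞 K ⧸ 𝔭.asIdeal)] (absIntegers (𝓞 K) K ⧸ 𝔓) :=
    Ideal.Quotient.stabilizerHom 𝔓 𝔭.asIdeal (absoluteGaloisGroup K) ⟨τ, hτ.mem_stabilizer⟩ with hφdef
  have hφ : ∀ x : (absIntegers (𝓞 K) K ⧸ 𝔓), φ x = x ^ Fintype.card (𝓞 K ⧸ 𝔭.asIdeal) := stabilizerHom_apply_eq_pow (K := K) τ hτ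
  set ξ : CyclicCoverDeck (absIntegers (𝓞 K) K ⧸ 𝔓) 3 := CyclicCoverDeck.reduceMod K 3 𝔓 (deckGen (isPrimitiveRoot_zeta3 K) ^ i) with hξdef
  -- transfer of the trace to the special fibre
  have htransfer : LinearMap.trace ℤ_[3] _
      (DistribSMul.toLinearMap ℤ_[3] (TateModule (GeomPic K 3 (f.map (algebraMap ℤ K))) 3) τ ∘ₗ
        DistribSMul.toLinearMap ℤ_[3] (TateModule (GeomPic K 3 (f.map (algebraMap ℤ K))) 3)
          (deckGen (isPrimitiveRoot_zeta3 K) ^ i)) =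
      LinearMap.trace ℤ_[3] _
        (DistribSMul.toLinearMap ℤ_[3] (TateModule (SuperellipticPic (𝓞 K ⧸ 𝔭.asIdeal) (absIntegers (𝓞 K) K ⧸ 𝔓) 3 ((f.map (algebraMap ℤ (𝓞 K))).map (Ideal.Quotient.mk 𝔭.asIdeal))) 3) φ ∘ₗ
          DistribSMul.toLinearMap ℤ_[3] (TateModule (SuperellipticPic (𝓞 K ⧸ 𝔭.asIdeal) (absIntegers (𝓞 K) K ⧸ 𝔓) 3 ((f.map (algebraMap ℤ (𝓞 K))).map (Ideal.Quotient.mk 𝔭.asIdeal))) 3) ξ) :=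
    trace_eq_of_injective_of_comp_eq hrank (TateModule.map 3 red)
      (TateModule.map_injective_of_forall_torsionBy red hinj) _ _
      (TateModule.map_comp_toLinearMap_eq red τ φ (fun c => hredτ ⟨τ, hτ.mem_stabilizer⟩ c) _ ξ
        (fun c => hredζ _ c))
  -- twisted Lefschetz on `V₃` of the special fibre
  have hlef := hX3 (𝓞 K ⧸ 𝔭.asIdeal) (absIntegers (𝓞 K) K ⧸ 𝔓) 3 3 ((f.map (algebraMap ℤ (𝓞 K))).map (Ideal.Quotient.mk 𝔭.asIdeal)) (by exact_mod_cast h3k) (by exact_mod_cast h3k) hsepb hndvdb φ hφ ξ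
  rw [trace_rationalTateRepresentation_comp] at hlef
  -- the fixed places of `Frob ∘ δ̄^i`
  have hfix := SuperellipticFunctionField.card_fixedPlaces_frobenius_deck (k := (𝓞 K ⧸ 𝔭.asIdeal)) (Ω := (absIntegers (𝓞 K) K ⧸ 𝔓)) (p := 3) (f := ((f.map (algebraMap ℤ (𝓞 K))).map (Ideal.Quotient.mk 𝔭.asIdeal))) φ hφ
    (by exact_mod_cast h3k) hsepb hndvdb hpq ξ
  -- the label condition in the two spellings
  have hξval : ξ.val = algebraMap (𝓞 K ⧸ 𝔭.asIdeal) (absIntegers (𝓞 K) K ⧸ 𝔓) (Ideal.Quotient.mk 𝔭.asIdeal (zeta3Int K ^ i)) :=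
    val_reduceMod_deckGen_pow (K := K) (𝔓 := 𝔓) i
  have hfilter : (Finset.univ.filter fun a : (𝓞 K ⧸ 𝔭.asIdeal) => ((f.map (algebraMap ℤ (𝓞 K))).map (Ideal.Quotient.mk 𝔭.asIdeal)).eval a ≠ 0 ∧
      algebraMap (𝓞 K ⧸ 𝔭.asIdeal) (absIntegers (𝓞 K) K ⧸ 𝔓) (((f.map (algebraMap ℤ (𝓞 K))).map (Ideal.Quotient.mk 𝔭.asIdeal)).eval a) ^ ((Fintype.card (𝓞 K ⧸ 𝔭.asIdeal) - 1) / 3) = ξ.val) =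
      (Finset.univ.filter fun a : (𝓞 K ⧸ 𝔭.asIdeal) =>
        (f.map ((Ideal.Quotient.mk 𝔭.asIdeal).comp (algebraMap ℤ (𝓞 K)))).eval a ≠ 0 ∧
          Ideal.Quotient.mk 𝔭.asIdeal (zeta3Int K ^ i) =
            (f.map ((Ideal.Quotient.mk 𝔭.asIdeal).comp (algebraMap ℤ (𝓞 K)))).eval a ^ ((𝔭.residueCard - 1) / 3)) := by
    refine Finset.filter_congr fun a _ => ?_
    rw [hfb', hξval, ← map_pow, hq]
    exact and_congr_right fun _ => ⟨fun h => ((algebraMap (𝓞 K ⧸ 𝔭.asIdeal) (absIntegers (𝓞 K) K ⧸ 𝔓)).injective h).symm,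
      fun h => congrArg (algebraMap (𝓞 K ⧸ 𝔭.asIdeal) (absIntegers (𝓞 K) K ⧸ 𝔓)) h.symm⟩
  have hfilter0 : (Finset.univ.filter fun a : (𝓞 K ⧸ 𝔭.asIdeal) => ((f.map (algebraMap ℤ (𝓞 K))).map (Ideal.Quotient.mk 𝔭.asIdeal)).eval a = 0) =
      (Finset.univ.filter fun a : (𝓞 K ⧸ 𝔭.asIdeal) =>
        (f.map ((Ideal.Quotient.mk 𝔭.asIdeal).comp (algebraMap ℤ (𝓞 K)))).eval a = 0) := by
    rw [hfb']
  -- the character sum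
  have hchar := picard_twistedCount_eq_characterSum (isPrimitiveRoot_zeta3Int K) h3𝔭 f hi
  -- assemble
  refine ⟨(Fintype.card (𝓞 K ⧸ 𝔭.asIdeal) : ℤ) + 1 -
    (Nat.card {P : PlaceOver (absIntegers (𝓞 K) K ⧸ 𝔓) (SuperellipticFunctionField (𝓞 K ⧸ 𝔭.asIdeal) (absIntegers (𝓞 K) K ⧸ 𝔓) 3 ((f.map (algebraMap ℤ (𝓞 K))).map (Ideal.Quotient.mk 𝔭.asIdeal))) // φ • (ξ • P) = P} : ℕ), ?_, ?_⟩
  · apply IsFractionRing.injective ℤ_[3] ℚ_[3]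
    rw [htransfer, hlef]
    simp only [map_sub, map_add, map_natCast, map_one, Int.cast_sub, Int.cast_add, Int.cast_natCast,
      Int.cast_one]
  · rw [hfix, hfilter, hfilter0, ← hchar]
    push_cast
    ring

end GoodPrime

/-! ### The Frobenius trace of `ρ₁` -/

include hX1 hX2 hX3 in
/-- **`tr ρ₁(Frob_𝔓) = j(a_𝔭(f))`** for `ρ₁` built with `u = j(ω)²` and `τ` an arithmetic Frobenius at
`𝔓 ∣ 𝔭`, `𝔭 ∤ 3` of good reduction: with `A = tr_{ℤ₃[ω]}(τ | T)`, `X = σ(A)`, `Y = σ̄(A)` and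
`m_i = tr_{ℤ₃}(τ δ^i | T)` one has `X + Y = m₀`, `uX + u²Y = m₁` (`σ + σ̄ = Tr`), while
`j(a) + j(a') = m₀`, `u j(a) + u² j(a') = m₁` (`picard_trace_frob_deck`, `u = j(ω)²`); the system being
nondegenerate (`u ≠ u²`), `X = j(a)`. [cite: Upton2009, §2, Thm. 2.1] -/
theorem trace_picardRho1_frob
    (hcard : ∀ n, Nat.card (AddSubgroup.torsionBy (GeomPic K 3 (f.map (algebraMap ℤ K))) (3 ^ n : ℕ)) = 3 ^ (2 * 3 * n))
    (b : Module.Basis (Fin 3) PadicEisenstein (TateModule (GeomPic K 3 (f.map (algebraMap ℤ K))) 3))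
    (j : K →+* PadicAlgCl 3) (hu : (j (zeta3 K) ^ 2) ^ 2 + j (zeta3 K) ^ 2 + 1 = 0)
    {𝔭 : HeightOneSpectrum (𝓞 K)} (h3𝔭 : (3 : 𝓞 K) ∉ 𝔭.asIdeal)
    (hdeg𝔭 : (f.map ((Ideal.Quotient.mk 𝔭.asIdeal).comp (algebraMap ℤ (𝓞 K)))).natDegree = 4)
    (hsep𝔭 : (f.map ((Ideal.Quotient.mk 𝔭.asIdeal).comp (algebraMap ℤ (𝓞 K)))).Separable)
    {𝔓 : Ideal (absIntegers (𝓞 K) K)} (h𝔓 : 𝔓 ∈ 𝔭.primesAbove)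
    (τ : absoluteGaloisGroup K) (hτ : IsArithFrobAt (𝓞 K) τ 𝔓) :
    FramedRep.trace (picardRho1 hcard b (j (zeta3 K) ^ 2) hu) τ = j (picardTrace f 𝔭 : K) := by
  haveI := HeightOneSpectrum.isMaximal_of_mem_primesAbove h𝔓
  haveI : 𝔓.LiesOver 𝔭.asIdeal := h𝔓.2
  set v := j (zeta3 K) with hv
  set u := v ^ 2 with hudef
  have hv3 : v ^ 3 = 1 := by rw [hv, ← map_pow, (isPrimitiveRoot_zeta3 K).pow_eq_one, map_one]
  have hv1 : v ≠ 1 := by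
    rw [hv, Ne, ← map_one j, j.injective.eq_iff]
    exact (isPrimitiveRoot_zeta3 K).ne_one (by norm_num)
  have hvq : v ^ 2 + v + 1 = 0 := by
    have h : (v - 1) * (v ^ 2 + v + 1) = 0 := by linear_combination hv3
    rcases mul_eq_zero.1 h with h | h
    · exact absurd (sub_eq_zero.1 h) hv1
    · exact h
  have hu' : (u ^ 2) ^ 2 + u ^ 2 + 1 = 0 := sq_sq_add_sq_add_one hu
  have hu2v : u ^ 2 = v := by rw [hudef]; linear_combination v * hv3
  -- the two integers `m₀, m₁`
  obtain ⟨m₀, hm₀, hm₀'⟩ := picard_trace_frob_deck (K := K) (f := f) hX1 hX2 hX3 h3𝔭 hdeg𝔭 hsep𝔭 (𝔓 := 𝔓) τ hτ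
    (i := 0) (by norm_num)
  obtain ⟨m₁, hm₁, hm₁'⟩ := picard_trace_frob_deck (K := K) (f := f) hX1 hX2 hX3 h3𝔭 hdeg𝔭 hsep𝔭 (𝔓 := 𝔓) τ hτ
    (i := 1) (by norm_num)
  rw [trace_frob_deck_eq_algebraTrace b τ] at hm₀ hm₁
  rw [pow_zero, one_mul] at hm₀
  rw [pow_one] at hm₁
  -- `A = tr_O(τ | T)`, `X = σ(A)`, `Y = σ̄(A)`
  set A : PadicEisenstein := LinearMap.trace PadicEisenstein _
    (DistribMulAction.toModuleEnd PadicEisenstein (TateModule (GeomPic K 3 (f.map (algebraMap ℤ K))) 3) τ) with hA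
  rw [trace_picardRho1 hcard b u hu τ]
  -- `X + Y = m₀`, `u X + u² Y = m₁`
  have e0 := lift_add_lift_sq_eq_algebraMap_trace u hu hu' A
  have e1 := lift_add_lift_sq_eq_algebraMap_trace u hu hu' (PadicEisenstein.omega * A)
  rw [hm₀, map_intCast] at e0
  rw [hm₁, map_intCast, map_mul, map_mul, PadicEisenstein.lift_omega, PadicEisenstein.lift_omega] at e1
  -- `j a + j a' = m₀`, `v² j a + v j a' = m₁`
  set J : 𝓞 K →+* PadicAlgCl 3 := j.comp (algebraMap (𝓞 K) K) with hJ
  have hJζ : J (zeta3Int K) = v := rfl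
  have e0' := congrArg J hm₀'
  have e1' := congrArg J hm₁'
  simp only [pow_zero, one_pow, one_mul, pow_one, map_add, map_mul, map_pow, map_intCast, hJζ] at e0' e1'
  change PadicEisenstein.lift u hu A = J (picardTrace f 𝔭)
  -- solve the `2 × 2` system
  have hv0 : v ≠ 0 := by
    rintro h0; rw [h0] at hv3; norm_num at hv3
  have hvv : v ^ 2 - v ≠ 0 := by
    rw [show v ^ 2 - v = v * (v - 1) by ring]
    exact mul_ne_zero hv0 (sub_ne_zero.2 hv1)
  have key : (v ^ 2 - v) * (PadicEisenstein.lift u hu A - J (picardTrace f 𝔭)) = 0 := by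
    linear_combination e1 + e1' - v * (e0 + e0') - (PadicEisenstein.lift u hu A) * hudef -
      (PadicEisenstein.lift (u ^ 2) hu' A) * hu2v
  exact sub_eq_zero.1 ((mul_eq_zero.1 key).resolve_left hvv)

end PicardLocal

/-! ### The theorem: the `λ`-adic representation of a Picard curve, from the three classical inputs -/

attribute [local instance] fact_irreducible_picard_inst picardEisensteinModule picard_isScalarTower_inst
  picard_smulCommClass_inst

/-- **Galois representations attached to Picard curves** (Upton 2009, Thm. 2.1 / §4), conditional
form: GIVEN (`hX1`) the torsion structure `Cl(F/M)[N] ≅ (ℤ/N)^{2g}` of the divisor class group of a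
function field over an algebraically closed constant field (Rosen Thm. 11.12; Milne AV 8.2, JV 1.1),
(`hX2`) good reduction of the divisor class group of `y^p = f(x)` at the primes `𝔭 ∤ p` where
`f mod 𝔭` stays separable of the same degree, as an equivariant reduction datum injective and
surjective on prime-to-`𝔭` torsion (Serre–Tate §1 Lemma 2 / Thm. 1 for Jacobians; Deuring), and
(`hX3`) the twisted Lefschetz trace formula `tr(Frob ∘ ξ | V_ℓ J(C̄)) = q + 1 - #Fix(Frob ∘ ξ)` for a
deck transformation `ξ` (Milne JV §11 Prop. 11.2 with `α = π ∘ ξ`) — the statement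
`picardCurve_exists_lambdaAdicRep` holds: for every quartic `f ∈ ℤ[X]` separable over `ℚ` and
`j : ℚ(ω) → ℚ̄₃` the representation `ρ = ρ₁^∨`, `ρ₁ : Γ_{ℚ(ω)} → GL₃(ℤ₃[ω]) → GL₃(ℚ̄₃)` the Tate
module `T₃ J(C_f) ≅ ℤ₃[ω]³` (`PicardTateModuleEisenstein`) through `ω ↦ j(ω)²`, is unramified at the
good `𝔭 ∤ 3` with `tr ρ(Frob_𝔭⁻¹) = j(a_𝔭(f))` (`picardRho1_isUnramifiedAt`, `trace_picardRho1_frob`)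
and absolutely irreducible when `Gal(f) ⊇ A₄` (`picardRho1_isAbsolutelyIrreducible`, residual
representation `≅ (𝔽₃^{roots})⁰`).  Everything except the three displayed inputs is proved in the
tree; the inputs are hypotheses, not named facts.
[cite: Upton2009, Thm. 2.1 and §4] [cite: SerreTate1968GoodReduction, §1, Thm. 1]
[cite: Milne1986JacobianVarieties, §11 Prop. 11.2] [cite: RosenFunctionFields2002, Ch. 11, Thm. 11.12] -/
theorem picardCurve_exists_lambdaAdicRep_of_torsion_goodReduction_lefschetz
    (hX1 : ∀ (M : Type) (F : Type) [Field M] [Field F] [Algebra M F] [IsAlgClosed M] [IsAlgFunctionField M F]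
      (N : ℕ), (N : M) ≠ 0 → Nonempty ((AddSubgroup.torsionBy (DivisorClass M F) N) ≃+ (Fin (2 * genus M F) → ZMod N)))
    (hX2 : ∀ (K : Type) [Field K] [NumberField K] (p : ℕ) [Fact p.Prime] (f : K[X]) (f₀ : (𝓞 K)[X]),
      f₀.map (algebraMap (𝓞 K) K) = f →
      ∀ (𝔭 : HeightOneSpectrum (𝓞 K)) (𝔓 : Ideal (absIntegers (𝓞 K) K)) [𝔓.IsMaximal] [𝔓.LiesOver 𝔭.asIdeal],
      (p : 𝓞 K) ∉ 𝔭.asIdeal → ¬ p ∣ f.natDegree →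
      (f₀.map (Ideal.Quotient.mk 𝔭.asIdeal)).natDegree = f.natDegree →
      (f₀.map (Ideal.Quotient.mk 𝔭.asIdeal)).Separable →
      ∀ [Fact (Irreducible (superellipticPoly K (AlgebraicClosure K) p f))]
        [Fact (Irreducible (superellipticPoly (𝓞 K ⧸ 𝔭.asIdeal) (absIntegers (𝓞 K) K ⧸ 𝔓) p
          (f₀.map (Ideal.Quotient.mk 𝔭.asIdeal))))],
      ∃ red : GeomPic K p f →+
          SuperellipticPic (𝓞 K ⧸ 𝔭.asIdeal) (absIntegers (𝓞 K) K ⧸ 𝔓) p (f₀.map (Ideal.Quotient.mk 𝔭.asIdeal)),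
        (∀ (τ : MulAction.stabilizer (absoluteGaloisGroup K) 𝔓) (c : GeomPic K p f),
            red ((τ : absoluteGaloisGroup K) • c) =
              (Ideal.Quotient.stabilizerHom 𝔓 𝔭.asIdeal (absoluteGaloisGroup K) τ) • red c) ∧
        (∀ (ζ : CyclicCoverDeck (AlgebraicClosure K) p) (c : GeomPic K p f),
            red (ζ • c) = CyclicCoverDeck.reduceMod K p 𝔓 ζ • red c) ∧
        (∀ N : ℕ, (N : 𝓞 K ⧸ 𝔭.asIdeal) ≠ 0 →
          (∀ c : GeomPic K p f, N • c = 0 → red c = 0 → c = 0) ∧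
          (∀ c', N • c' = 0 → ∃ c : GeomPic K p f, N • c = 0 ∧ red c = c')))
    (hX3 : ∀ (k : Type) [Field k] [Fintype k] (Ω : Type) [Field Ω] [Algebra k Ω] [IsAlgClosed Ω]
      [Algebra.IsAlgebraic k Ω] (p : ℕ) [Fact p.Prime] (ℓ : ℕ) [Fact ℓ.Prime] (f : k[X]),
      (p : k) ≠ 0 → (ℓ : k) ≠ 0 → f.Separable → ¬ p ∣ f.natDegree →
      ∀ [Fact (Irreducible (superellipticPoly k Ω p f))] (φ : Ω ≃ₐ[k] Ω), (∀ x : Ω, φ x = x ^ Fintype.card k) →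
      ∀ (ξ : CyclicCoverDeck Ω p),
        LinearMap.trace ℚ_[ℓ] (RationalTateModule (SuperellipticPic k Ω p f) ℓ)
          (rationalTateRepresentation (Ω ≃ₐ[k] Ω) (SuperellipticPic k Ω p f) ℓ φ ∘ₗ
            rationalTateRepresentation (CyclicCoverDeck Ω p) (SuperellipticPic k Ω p f) ℓ ξ) =
          (Fintype.card k : ℚ_[ℓ]) + 1 -
            Nat.card {P : PlaceOver Ω (SuperellipticFunctionField k Ω p f) // φ • (ξ • P) = P}) :
    picardCurve_exists_lambdaAdicRep := by
  intro f h4 hsep j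
  classical
  haveI : IsCyclotomicExtension {3} ℚ (CyclotomicField 3 ℚ) := CyclotomicField.isCyclotomicExtension 3 ℚ
  haveI hf4 : Fact (f.natDegree = 4) := ⟨h4⟩
  haveI hfs : Fact (f.map (Int.castRingHom ℚ)).Separable := ⟨hsep⟩
  -- `#J_f[3ⁿ] = 3^{6n}` (from `hX1`) and a `ℤ₃[ω]`-basis adapted to `J[λ] ≅ (𝔽₃^{roots})⁰`
  have hcard := picard_hcard_of_hX1 (K := CyclotomicField 3 ℚ) (f := f) hX1
  obtain ⟨r₀, b, hb⟩ := picard_exists_basis_repr_smul_congr (CyclotomicField 3 ℚ) f h4 hsep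
    (isPrimitiveRoot_zeta3 (CyclotomicField 3 ℚ)) hcard
  have hR4 : Fintype.card ((f.map (algebraMap ℤ (CyclotomicField 3 ℚ))).rootSet (AlgebraicClosure (CyclotomicField 3 ℚ))) = 4 :=
    card_rootSet_map_algebraMap_int (CyclotomicField 3 ℚ) h4 hsep
  have hι : Fintype.card {y : (f.map (algebraMap ℤ (CyclotomicField 3 ℚ))).rootSet
      (AlgebraicClosure (CyclotomicField 3 ℚ)) // y ≠ r₀} = 3 := by
    rw [Fintype.card_subtype_compl, hR4, Fintype.card_subtype_eq]
  set e := Fintype.equivFinOfCardEq hι with he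
  -- `u = j(ω)²`, the other primitive cube root of unity of `ℚ̄₃`
  have hv : j (zeta3 (CyclotomicField 3 ℚ)) ^ 2 + j (zeta3 (CyclotomicField 3 ℚ)) + 1 = 0 := by
    set v := j (zeta3 (CyclotomicField 3 ℚ)) with hvdef
    have hv3 : v ^ 3 = 1 := by
      rw [hvdef, ← map_pow, (isPrimitiveRoot_zeta3 (CyclotomicField 3 ℚ)).pow_eq_one, map_one]
    have hv1 : v ≠ 1 := by
      rw [hvdef, Ne, ← map_one j, j.injective.eq_iff]
      exact (isPrimitiveRoot_zeta3 (CyclotomicField 3 ℚ)).ne_one (by norm_num)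
    have h : (v - 1) * (v ^ 2 + v + 1) = 0 := by linear_combination hv3
    rcases mul_eq_zero.1 h with h | h
    · exact absurd (sub_eq_zero.1 h) hv1
    · exact h
  have hu : (j (zeta3 (CyclotomicField 3 ℚ)) ^ 2) ^ 2 + j (zeta3 (CyclotomicField 3 ℚ)) ^ 2 + 1 = 0 :=
    sq_sq_add_sq_add_one hv
  -- `ρ = ρ₁^∨`
  refine ⟨FramedRep.dual (picardRho1 hcard (b.reindex e) (j (zeta3 (CyclotomicField 3 ℚ)) ^ 2) hu), ?_, ?_⟩
  · intro 𝔭 h3 hdeg𝔭 hsep𝔭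
    refine ⟨(FramedGaloisRep.isUnramifiedAt_dual_iff 𝔭 _).2
      (picardRho1_isUnramifiedAt (K := CyclotomicField 3 ℚ) (f := f) hX2 h3 hdeg𝔭 hsep𝔭 hcard _ _ hu), ?_⟩
    intro 𝔓 h𝔓 τ hτ
    rw [FramedRep.trace_dual, inv_inv]
    exact trace_picardRho1_frob (K := CyclotomicField 3 ℚ) (f := f) hX1 hX2 hX3 hcard _ j hu h3 hdeg𝔭 hsep𝔭 h𝔓 τ hτ
  · intro h12
    exact (picardRho1_isAbsolutelyIrreducible (K := CyclotomicField 3 ℚ) (f := f) hcard h12 e b hb _ hu).dual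

end Literature.NumberTheory.GaloisRepresentations
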